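import Literature.AnabelianGeometry.EtaleTheta.DoubleUnderline
import Literature.AnabelianGeometry.EtaleTheta.ThetaCohomologyInversion
import Literature.AnabelianGeometry.EtaleTheta.TemperedRigidity
import Literature.AnabelianGeometry.EtaleTheta.MuTwoSettingCLevel
import HarnessLib

/-!
# [EtTh] Def. 2.5 (i)(b) for the choice `X̲̲`: «compatible with the `{±1}`-structure» and «determined by a splitting of
# `D_x ↠ G_K`» — the class-(c) PREDICATES `DoubleUnderline.IotaStable` / `DoubleUnderline.CuspAdapted`
# (L2 v-next census item C10, predicate route; binder-swap API, no interface field)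

Mochizuki, *The Étale Theta Function and its Frobenioid-theoretic Manifestations* [EtTh], Publ. RIMS **45**
(2009), §2, Def. 2.5 (i) PRIMS PDF p. 39: «Suppose that `K̈ = K`. Then … the finite étale covering `X̲̲ → X` … [is]
determined … by the choice of a splitting of `D_x → G_K` [cf. Proposition 2.2 (iii)] … compatible with the
`{±1}`-structure of Theorem 1.10, (iii)», Def. 2.3 p. 38, Def. 2.7 p. 41, Prop. 2.2 (iii) p. 37; Def. 2.1 p. 36
(«`ι ∈ Δ_C`, an element that lifts the nontrivial element of `Gal(X/C) ≅ ℤ/2ℤ`») [cite: MochizukiEtTh2009, Def 2.5 (i) p.39].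
Cell `abc-iut`, layer L2, seat abc-iut-L2-t8 (gen 6; owner of `EtaleThetaData.DoubleUnderline`); L2 v-next census item
**C10** (chair abc-iut-L2-lead gen 4, `plan/L2/VNEXT-CENSUS-L2.md`; drafter abc-iut-L2-t3: «`EtaleThetaData.DoubleUnderline`
carries no ι-stability»; certificate abc-iut-L2-d3 07:07:55Z; ruling R269 «C10-P»).  DEFINITIONS (two `Prop`-valued
predicates, one restricted automorphism) + kernel-checked structural lemmas; no instance, no notation, no new named fact,
no interface field; nothing of another seat is edited or restated.

WHY A PREDICATE AND NOT A FIELD (§0a constructor-site principle).  This seat's frozen `EtaleThetaData.DoubleUnderline E l`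
(`DoubleUnderline.lean`) records the choice `X̲̲` over a §1 theta setting `D` by SIX clauses on the open subgroup
`Π^tp_X̲̲ = C.Huu ≤ Π^tp_X`; its docstring says that Def. 2.5 (i)'s second condition «compatible with the `{±1}`-structure»
has no carrier there.  That condition is a RELATION between `X̲̲` and an EXTRA datum — an inversion `ι` of `Π^tp_X`
(abc-iut-L2-t1's `ThetaSetting.IsInversionAut D ι`, `ι : Π^tp_X ≃ₜ* Π^tp_X`; at the C-level, abc-iut-L2-d3's restricted
inner automorphisms `e.conjX g` of `Π^tp_C`, `MuTwoSettingCLevel`) resp. a cusp `x : D.Pt` — neither of which is in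
scope inside the structure; and the drafted «∀ `g ∈ Π^tp_C`» form is FALSE at every constructor site (`Π^tp_X̲̲` is not
even normal in `Π^tp_X`: abc-iut-L2-d1's `SettingModel.not_normal_Huuχ`, as in print, where `X̲̲ → X̲ → X` is the
non-Galois degree-`l` covering).  Hence (R269, predicate route) the two clauses become PREDICATES ON `(C, ι)` / `(C, x)`:

* `C.IotaStable ι` :⟺ `ι(Π^tp_X̲̲) = Π^tp_X̲̲` (`C.Huu.map ι = C.Huu`) — EXACTLY the raw binder
  `hι : C.Huu.map ι.toMulEquiv.toMonoidHom = C.Huu` carried today by abc-iut-L2-t2's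
  `Discharge/Sec2Prop214iiiInversionOfModel` (`symm_mem_GtpYdduu`, `rigidData_exists_monoIso_over_inversion`, …),
  abc-iut-w5-d072's `EtaleThetaDataOfSetting.inversionAlpha C ι hι` and its abc-iut-w4-d010 consumers — they swap to
  `(hι : C.IotaStable ι)` / `hι.map_Huu` BY NAME;
* `C.CuspAdapted x` :⟺ `(D_x ∩ Π^tp_X̲̲) ↠ G_K` (`(D.decomp x ⊓ C.Huu).map aug = G_K`) — the splitting of `D_x ↠ G_K`
  determining `X̲̲` lies in `Π^tp_X̲̲` (census P-C6 «cusp-adaptedness», group-theoretic shadow).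

API (binder-swap lemmas): `IotaStable.map_Huu` / `iotaStable_iff`, `.mem_iff`, `iotaStable_refl`, `.symm`, `.trans`,
`.of_mem_iff`; stability of `Π^tp_Ÿ̲̲ = Π^tp_Ÿ ∩ Π^tp_X̲̲` (`.map_GtpYdd_inf_Huu`, from abc-iut-L2-t1's `Thm16i ι`) and of
`Π^tp_Y̲̲` (`.map_GtpY_inf_Huu`, from `IsInversionAut`); the restriction `IotaStable.restrict : Π^tp_X̲̲ ≃ₜ* Π^tp_X̲̲` with
`coe_restrict` (the `(φ, hφ)` binder pair of the Prop. 2.14 (iii) consumers; same term as abc-iut-w5-d072's IUT-layer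
`inversionAlpha`, provided at the [EtTh] layer); the C-LEVEL junction `iotaStable_conjX_iff` —
`C.IotaStable (e.conjX g) ↔ (C.Huu.map inclX).map (conj g) = C.Huu.map inclX` (the census text's `inv_stable` clause for ONE
`g ∈ Π^tp_C`, e.g. an inversion `ε_±`); `CuspAdapted.exists_mem_aug_eq`, `.GK_le_map_aug_decomp`.
NON-VACUITY is abc-iut-L2-d1's, BY NAME, in the proof-only sequel `SettingModelDoubleUnderlineIotaStable` (stage 1:
`map_Huuχ_twistedInversion` at `doubleUnderlineχSec`; stage 2: `map_Huuχq_inversionχq` at `doubleUnderlineχqOfEtaRes`;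
cusp clause: `map_aug_decomp_inf_Huuχ_modelχ'` at the cusped χ-model; vacuous at `modelχ`, whose `Pt` is empty).
HONEST FRAMING: [EtTh] is refereed and is typed, not endorsed; nothing here asserts anything about an actual curve; no side
is taken on [IUTchIII] Cor. 3.12; typed ≠ proved.
-/

noncomputable section

namespace Literature.AnabelianGeometry.EtaleTheta

open Literature.AnabelianGeometry.SemiGraphs

namespace ThetaSetting

namespace EtaleThetaData.DoubleUnderline

variable {p : ℕ} [Fact p.Prime] {D : ThetaSetting p} {E : D.EtaleThetaData} {l : ℕ} (C : E.DoubleUnderline l)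

/-! ### Def. 2.5 (i)(b), first clause: `X̲̲` is compatible with the `{±1}`-structure -/

/-- **[EtTh] Def. 2.5 (i)(b), `{±1}`-compatibility of the choice `X̲̲`, as a predicate on `(X̲̲, ι)`**: the
(inversion) automorphism `ι` of `Π^tp_X` carries `Π^tp_X̲̲` onto itself, `ι(Π^tp_X̲̲) = Π^tp_X̲̲` («compatible with the
`{±1}`-structure of Theorem 1.10, (iii)», p. 39; Def. 2.1 p. 36: the inversion is conjugation by `ι ∈ Π^tp_C ∖ Π^tp_X`).
This is the raw binder `hι` of the Prop. 2.14 (iii) `{±1}`-part consumers, named. [cite: MochizukiEtTh2009, Def 2.5 (i) p.39] -/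
@[mk_iff]
structure IotaStable (ι : D.PiTemp ≃ₜ* D.PiTemp) : Prop where
  /-- `ι(Π^tp_X̲̲) = Π^tp_X̲̲` -/
  map_Huu : C.Huu.map ι.toMulEquiv.toMonoidHom = C.Huu

/-! ### Def. 2.5 (i)(b), second clause: `X̲̲ → X` is determined by a splitting of `D_x ↠ G_K` -/

/-- **[EtTh] Def. 2.5 (i)(b), cusp-adaptedness of the choice `X̲̲`, as a predicate on `(X̲̲, x)`**: the decomposition
group `D_x ⊆ Π^tp_X` of the point `x` meets `Π^tp_X̲̲` in a subgroup mapping ONTO `G_K` — the group-theoretic shadow of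
«`X̲̲ → X` … determined … by the choice of a splitting of `D_x → G_K` [cf. Proposition 2.2 (iii)]» (p. 39): the
splitting lands in `D_x ∩ Π^tp_X̲̲`. [cite: MochizukiEtTh2009, Def 2.5 (i) p.39] -/
@[mk_iff]
structure CuspAdapted (x : D.Pt) : Prop where
  /-- `(D_x ∩ Π^tp_X̲̲) ↠ G_K` -/
  map_aug_decomp_inf_Huu : (D.decomp x ⊓ C.Huu).map D.aug.toMonoidHom = D.GK

/-! ### Binder-swap API for `IotaStable` -/

namespace IotaStable

variable {C} {ι ι' : D.PiTemp ≃ₜ* D.PiTemp}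

/-- Membership in `Π^tp_X̲̲` is `ι`-invariant: `ι g ∈ Π^tp_X̲̲ ↔ g ∈ Π^tp_X̲̲`. [cite: MochizukiEtTh2009, Def 2.5 (i) p.39] -/
theorem mem_iff (h : C.IotaStable ι) (g : D.PiTemp) : ι g ∈ C.Huu ↔ g ∈ C.Huu := by
  constructor
  · intro hg
    have hg' : ι g ∈ C.Huu.map ι.toMulEquiv.toMonoidHom := by rw [h.map_Huu]; exact hg
    obtain ⟨y, hy, hyg⟩ := hg'
    have : y = g := ι.injective hyg
    exact this ▸ hy
  · intro hg
    rw [← h.map_Huu]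
    exact ⟨g, hg, rfl⟩

/-- `ι⁻¹ g ∈ Π^tp_X̲̲ ↔ g ∈ Π^tp_X̲̲`. [cite: MochizukiEtTh2009, Def 2.5 (i) p.39] -/
theorem symm_mem_iff (h : C.IotaStable ι) (g : D.PiTemp) : ι.symm g ∈ C.Huu ↔ g ∈ C.Huu := by
  rw [← h.mem_iff (ι.symm g), ContinuousMulEquiv.apply_symm_apply]

/-- `ι⁻¹` stabilises `Π^tp_X̲̲` as well. [cite: MochizukiEtTh2009, Def 2.5 (i) p.39] -/
theorem symm (h : C.IotaStable ι) : C.IotaStable ι.symm := by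
  refine ⟨Subgroup.ext fun g => ?_⟩
  constructor
  · rintro ⟨y, hy, rfl⟩
    exact (h.symm_mem_iff y).2 hy
  · intro hg
    exact ⟨ι g, (h.mem_iff g).2 hg, ι.symm_apply_apply g⟩

/-- Composites of stabilising automorphisms stabilise. [cite: MochizukiEtTh2009, Def 2.5 (i) p.39] -/
theorem trans (h : C.IotaStable ι) (h' : C.IotaStable ι') : C.IotaStable (ι.trans ι') := by
  refine ⟨Subgroup.ext fun g => ?_⟩
  constructor
  · rintro ⟨y, hy, rfl⟩
    exact (h'.mem_iff _).2 ((h.mem_iff y).2 hy)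
  · intro hg
    refine ⟨ι.symm (ι'.symm g), (h.symm_mem_iff _).2 ((h'.symm_mem_iff g).2 hg), ?_⟩
    change ι' (ι (ι.symm (ι'.symm g))) = g
    rw [ι.apply_symm_apply, ι'.apply_symm_apply]

/-- A membership criterion suffices: if `ι g ∈ Π^tp_X̲̲ ↔ g ∈ Π^tp_X̲̲` for all `g`, then `ι(Π^tp_X̲̲) = Π^tp_X̲̲` (the
shape in which the χ-models prove it). [cite: MochizukiEtTh2009, Def 2.5 (i) p.39] -/
theorem of_mem_iff (hmem : ∀ g : D.PiTemp, ι g ∈ C.Huu ↔ g ∈ C.Huu) : C.IotaStable ι := by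
  refine ⟨Subgroup.ext fun g => ?_⟩
  constructor
  · rintro ⟨y, hy, rfl⟩
    exact (hmem y).2 hy
  · intro hg
    refine ⟨ι.symm g, (hmem _).1 ?_, ι.apply_symm_apply g⟩
    rw [ι.apply_symm_apply]
    exact hg

/-- **`ι(Π^tp_Ÿ̲̲) = Π^tp_Ÿ̲̲`** for `Π^tp_Ÿ̲̲ = Π^tp_Ÿ ∩ Π^tp_X̲̲`, from `ι(Π^tp_Ÿ) = Π^tp_Ÿ` (abc-iut-L2-t1's `Thm16i ι`,
e.g. `IsInversionAut.thm16i`) and `ι(Π^tp_X̲̲) = Π^tp_X̲̲` — the binder pair `(h, hι)` of abc-iut-L2-t2's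
`symm_mem_GtpYdduu`. [cite: MochizukiEtTh2009, Def 2.7 p.41] -/
theorem map_GtpYdd_inf_Huu (hY : Thm16i ι) (h : C.IotaStable ι) :
    (D.GtpYdd ⊓ C.Huu).map ι.toMulEquiv.toMonoidHom = D.GtpYdd ⊓ C.Huu := by
  rw [Subgroup.map_inf_eq _ _ _ ι.injective, h.map_Huu]
  exact congrArg (· ⊓ C.Huu) hY

/-- **`ι(Π^tp_Y̲̲) = Π^tp_Y̲̲`** for `Π^tp_Y̲̲ = Π^tp_Y ∩ Π^tp_X̲̲`, for an inversion automorphism in abc-iut-L2-t1's sense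
(`IsInversionAut.map_GtpY`). [cite: MochizukiEtTh2009, Def 2.7 p.41] -/
theorem map_GtpY_inf_Huu (hι : D.IsInversionAut ι) (h : C.IotaStable ι) :
    (D.GtpY ⊓ C.Huu).map ι.toMulEquiv.toMonoidHom = D.GtpY ⊓ C.Huu := by
  rw [Subgroup.map_inf_eq _ _ _ ι.injective, h.map_Huu, hι.map_GtpY]

/-- `Π^tp_Ÿ̲̲`-membership is `ι`-invariant (given `Thm16i ι`). [cite: MochizukiEtTh2009, Def 2.7 p.41] -/
theorem mem_GtpYdd_inf_Huu_iff (hY : Thm16i ι) (h : C.IotaStable ι) (g : D.PiTemp) :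
    ι g ∈ D.GtpYdd ⊓ C.Huu ↔ g ∈ D.GtpYdd ⊓ C.Huu := by
  constructor
  · intro hg
    have hg' : ι g ∈ (D.GtpYdd ⊓ C.Huu).map ι.toMulEquiv.toMonoidHom := by rw [h.map_GtpYdd_inf_Huu hY]; exact hg
    obtain ⟨y, hy, hyg⟩ := hg'
    have : y = g := ι.injective hyg
    exact this ▸ hy
  · intro hg
    rw [← h.map_GtpYdd_inf_Huu hY]
    exact ⟨g, hg, rfl⟩

/-- **`ι|Π^tp_X̲̲ : Π^tp_X̲̲ ≃ₜ* Π^tp_X̲̲`**, the restriction of a stabilising automorphism (the `(φ, hφ)` binder pair of the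
Prop. 2.14 (iii) `{±1}`-part consumers; [IUTchII] Rmk. 1.4.1 (ii): the pointed inversion of `X̲̲`; same term as
abc-iut-w5-d072's IUT-layer `inversionAlpha`). [cite: MochizukiEtTh2009, Def 2.5 (i) p.39] -/
def restrict (h : C.IotaStable ι) : ↥C.Huu ≃ₜ* ↥C.Huu where
  toMulEquiv := (ι.toMulEquiv.subgroupMap C.Huu).trans (MulEquiv.subgroupCongr h.map_Huu)
  continuous_toFun := continuous_induced_rng.2 (by exact ι.continuous.comp continuous_subtype_val)
  continuous_invFun := continuous_induced_rng.2 (by exact ι.symm.continuous.comp continuous_subtype_val)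

/-- `ι|Π^tp_X̲̲` is `ι` on underlying elements. [cite: MochizukiEtTh2009, Def 2.5 (i) p.39] -/
@[simp] theorem coe_restrict (h : C.IotaStable ι) (g : C.Huu) : ((h.restrict g : C.Huu) : D.PiTemp) = ι (g : D.PiTemp) :=
  rfl

/-- `(ι|Π^tp_X̲̲)⁻¹` is `ι⁻¹` on underlying elements. [cite: MochizukiEtTh2009, Def 2.5 (i) p.39] -/
@[simp] theorem coe_restrict_symm (h : C.IotaStable ι) (g : C.Huu) :
    ((h.restrict.symm g : C.Huu) : D.PiTemp) = ι.symm (g : D.PiTemp) :=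
  rfl

/-- The `(φ, hφ)` binder pair of the `{±1}`-part consumers is inhabited under `IotaStable`.
[cite: MochizukiEtTh2009, Def 2.5 (i) p.39] -/
theorem exists_restrict (h : C.IotaStable ι) :
    ∃ φ : ↥C.Huu ≃ₜ* ↥C.Huu, ∀ g : C.Huu, ((φ g : C.Huu) : D.PiTemp) = ι (g : D.PiTemp) :=
  ⟨h.restrict, h.coe_restrict⟩

end IotaStable

/-- The identity stabilises `Π^tp_X̲̲`. [cite: MochizukiEtTh2009, Def 2.5 (i) p.39] -/
theorem iotaStable_refl : C.IotaStable (ContinuousMulEquiv.refl D.PiTemp) :=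
  IotaStable.of_mem_iff fun _ => Iff.rfl

/-- Conjugation by an element OF `Π^tp_X̲̲` stabilises `Π^tp_X̲̲` (trivially) — recorded to contrast with conjugation by a
general element of `Π^tp_X`, which does NOT (`Π^tp_X̲̲` is not normal in `Π^tp_X`; abc-iut-L2-d1's `not_normal_Huuχ` at the
χ-model): `IotaStable` is a condition on the EXTRA datum `ι`. [cite: MochizukiEtTh2009, Def 2.5 (i) p.39] -/
theorem iotaStable_of_forall_mem_iff {ι : D.PiTemp ≃ₜ* D.PiTemp} {g₀ : D.PiTemp} (hg₀ : g₀ ∈ C.Huu)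
    (hι : ∀ g, ι g = g₀ * g * g₀⁻¹) : C.IotaStable ι :=
  IotaStable.of_mem_iff fun g => by
    rw [hι g]
    constructor
    · intro h
      have h' := C.Huu.mul_mem (C.Huu.mul_mem (C.Huu.inv_mem hg₀) h) hg₀
      simpa [mul_assoc] using h'
    · intro h
      exact C.Huu.mul_mem (C.Huu.mul_mem hg₀ h) (C.Huu.inv_mem hg₀)

/-! ### Binder-swap API for `CuspAdapted` -/

namespace CuspAdapted

variable {C} {x : D.Pt}

/-- Every `σ ∈ G_K` lifts into `D_x ∩ Π^tp_X̲̲`. [cite: MochizukiEtTh2009, Def 2.5 (i) p.39] -/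
theorem exists_mem_aug_eq (h : C.CuspAdapted x) {σ : GQp p} (hσ : σ ∈ D.GK) :
    ∃ g ∈ D.decomp x ⊓ C.Huu, D.aug g = σ := by
  have hσ' : σ ∈ (D.decomp x ⊓ C.Huu).map D.aug.toMonoidHom := by rw [h.map_aug_decomp_inf_Huu]; exact hσ
  obtain ⟨g, hg, rfl⟩ := hσ'
  exact ⟨g, hg, rfl⟩

/-- `D_x ↠ G_K` (the image of `D_x` in `G_{ℚ_p}` contains `G_K`). [cite: MochizukiEtTh2009, Prop 2.2 (iii) p.37] -/
theorem GK_le_map_aug_decomp (h : C.CuspAdapted x) : D.GK ≤ (D.decomp x).map D.aug.toMonoidHom := by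
  rw [← h.map_aug_decomp_inf_Huu]
  exact Subgroup.map_mono inf_le_left

/-- The image of `D_x ∩ Π^tp_X̲̲` is contained in the image of `Π^tp_X̲̲`, which is `G_K` (`map_aug_Huu`) — so the clause
says the two images COINCIDE. [cite: MochizukiEtTh2009, Prop 2.2 (iii) p.37] -/
theorem map_aug_decomp_inf_Huu_eq_map_aug_Huu (h : C.CuspAdapted x) :
    (D.decomp x ⊓ C.Huu).map D.aug.toMonoidHom = C.Huu.map D.aug.toMonoidHom := by
  rw [h.map_aug_decomp_inf_Huu, C.map_aug_Huu]

end CuspAdapted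

/-- The cusp clause from a membership criterion: if every `σ ∈ G_K` has a lift in `D_x ∩ Π^tp_X̲̲`, then `X̲̲` is adapted to
`x` (the converse inclusion is automatic from `map_aug_Huu`). [cite: MochizukiEtTh2009, Def 2.5 (i) p.39] -/
theorem cuspAdapted_of_forall_exists {x : D.Pt} (hx : ∀ σ ∈ D.GK, ∃ g ∈ D.decomp x ⊓ C.Huu, D.aug g = σ) :
    C.CuspAdapted x := by
  refine ⟨le_antisymm ?_ fun σ hσ => ?_⟩
  · rw [← C.map_aug_Huu]
    exact Subgroup.map_mono inf_le_right
  · obtain ⟨g, hg, rfl⟩ := hx σ hσ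
    exact ⟨g, hg, rfl⟩

end EtaleThetaData.DoubleUnderline

end ThetaSetting

/-! ### The C-level junction: `IotaStable` for the restricted inner automorphisms of `Π^tp_C` -/

namespace MuTwoSetting.CLevelData

variable {p : ℕ} [Fact p.Prime] {M : MuTwoSetting p} (e : M.CLevelData)
  {E : M.toThetaSetting.EtaleThetaData} {l : ℕ} (C : E.DoubleUnderline l)

/-- **C-level form of Def. 2.5 (i)(b)**: for `g ∈ Π^tp_C`, `X̲̲` is stable under the restricted inner automorphism
`conjX g` of abc-iut-L2-d3's C-level data iff `inclX(Π^tp_X̲̲)` is normalised by `g` in `Π^tp_C`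
(`(Huu.map inclX).map (conj g) = Huu.map inclX` — the census text's `inv_stable` clause, for ONE `g`, e.g. an inversion
`ε_± ∈ Π^tp_C ∖ Π^tp_X`; it fails for general `g`, `Π^tp_X̲̲` not being normal). [cite: MochizukiEtTh2009, Def 2.1 p.36] -/
theorem iotaStable_conjX_iff (g : M.GtpC) :
    C.IotaStable (e.conjX g) ↔ (C.Huu.map M.inclX).map (MulAut.conj g).toMonoidHom = C.Huu.map M.inclX := by
  rw [C.iotaStable_iff, ← e.map_inclX_map_conjX g C.Huu]
  exact ⟨fun h => by rw [h], fun h => Subgroup.map_injective M.injective_inclX h⟩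

/-- Elements of `inclX(Π^tp_X̲̲)` itself give stabilising `conjX`. [cite: MochizukiEtTh2009, Def 2.1 p.36] -/
theorem iotaStable_conjX_inclX {y : M.PiTemp} (hy : y ∈ C.Huu) : C.IotaStable (e.conjX (M.inclX y)) :=
  C.iotaStable_of_forall_mem_iff hy fun x => e.conjX_inclX y x

end MuTwoSetting.CLevelData

end Literature.AnabelianGeometry.EtaleTheta

end
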